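import Summits.Ventures.LatticeQCDFlow.Scoring.OnePlaquetteBessel
import Summits.Ventures.LatticeQCDFlow.Scoring.U1TorusPlaquetteBounds
import Mathlib.Analysis.SpecialFunctions.Gaussian.GaussianIntegral
import HarnessLib

/-!
# Moments of the plaquette angle under `e^{β cos v}` on `[−π, π]`: integration-by-parts identities and a Gaussian sixth-moment bound

HONEST FRAMING: exact (Metropolis-corrected) sampling algorithms for lattice gauge theory;
figures of merit are autocorrelation/cost numbers at stated couplings and volumes; no
continuum-physics claim.

Venture `LatticeQCDFlow` (cell pub-lqcd), sub-topic `Scoring`; FANOUT row 5 (`s0-sun-a`), GEN-15.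
NEW WORK of the cell (placement rule).  The infinite-volume topological susceptibility of 2-d
`U(1)` is `χ_∞(β) = ⟨v²⟩_β/(4π²)` with `⟨v²⟩_β = ∫_{−π}^{π} v² e^{β cos v} dv / ∫_{−π}^{π} e^{β cos v} dv`
(`Scoring/U1TorusTopologicalSusceptibilityFiniteVolume.lean`, `chiInf_eq_single_plaquette`).  This
file collects the elementary inputs of its weak-coupling (`β → ∞`) law
(`Scoring/PlaquetteAngleSecondMomentWeakCoupling.lean`), all for the weight `w_β(v) = e^{β cos v}`
on the symmetric period `[−π, π]`:

* normalisations `∫ w_β = 2π I₀(β)`, `∫ cos v · w_β = 2π I₁(β)`;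
* **integration by parts** `∫ F' w_β = (F(π) − F(−π)) e^{−β} + β ∫ F sin v · w_β`, whence
  `β ∫ v sin v · w_β = 2π I₀(β) − 2π e^{−β}`, `β ∫ sin² v · w_β = 2π I₁(β)`,
  `β ∫ v³ sin v · w_β = 3 ∫ v² w_β − 2π³ e^{−β}`;
* **pointwise inequalities** `v sin v ≤ v²`, `v² ≤ sin² v + v⁴/3`, `v⁴ ≤ v³ sin v + v⁶/6`,
  `2(1 − cos v) ≤ v²`, `sin² v ≤ 2(1 − cos v)` (all real `v`; the first and last stated with the
  weight `e^{β cos v}` attached, as used);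
* **Gaussian domination** (`cos v ≤ 1 − 2v²/π²` on `[−π, π]`, `t³ e^{−ct} ≤ 27 e^{−3}/c³`):
  `∫ v⁶ w_β ≤ 27 e^{−3} π⁶ β^{−3} · e^β · √(π³/β)` for `β > 0`, and the lower bound
  `∫ w_β ≥ (5/3) e^β/√β` for `β ≥ 1` (`e^{β cos v} ≥ e^β (1 − βv²/2)` on `|v| ≤ 1/√β`), hence
  **`⟨v⁶⟩_β ≤ (81/5) e^{−3} π⁷ √π / β³`** for `β ≥ 1`.

Elementary real analysis on top of Mathlib (`integral_gaussian`, `Real.cos_le_one_sub_mul_cos_sq`,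
`Real.sin_gt_sub_cube`, `Real.add_one_le_exp`); nothing is cited.  No sampler values.
-/

noncomputable section

open Real MeasureTheory Set intervalIntegral
open Literature.Analysis.FunctionSpaces

namespace Summit.Ventures.LatticeQCDFlow.Scoring

/-! ### 1. Normalisations on the symmetric period -/

/-- `∫_{−π}^{π} e^{β cos v} dv = 2π I₀(β)` (periodicity and `Scoring/OnePlaquetteBessel.lean`). -/
theorem integral_exp_mul_cos_neg_pi_pi (β : ℝ) :
    ∫ v in (-π)..π, Real.exp (β * Real.cos v) = 2 * π * besselI 0 β := by
  have hp : Function.Periodic (fun v => Real.exp (β * Real.cos v)) (2 * π) := fun v => by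
    simp only [Real.cos_add_two_pi]
  have h := hp.intervalIntegral_add_eq (-π) 0
  rw [show -π + 2 * π = π by ring, zero_add] at h
  rw [h, ← onePlaquetteZ_eq_besselI, onePlaquetteZ]

/-- `∫_{−π}^{π} cos v · e^{β cos v} dv = 2π I₁(β)`. -/
theorem integral_cos_mul_exp_mul_cos_neg_pi_pi (β : ℝ) :
    ∫ v in (-π)..π, Real.cos v * Real.exp (β * Real.cos v) = 2 * π * besselI 1 β := by
  have hp : Function.Periodic (fun v => Real.cos v * Real.exp (β * Real.cos v)) (2 * π) :=
    fun v => by simp only [Real.cos_add_two_pi]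
  have h := hp.intervalIntegral_add_eq (-π) 0
  rw [show -π + 2 * π = π by ring, zero_add] at h
  rw [h, integral_cos_mul_exp_mul_cos]

/-- `∫_{−π}^{π} e^{β cos v} dv > 0`. -/
theorem integral_exp_mul_cos_neg_pi_pi_pos (β : ℝ) :
    0 < ∫ v in (-π)..π, Real.exp (β * Real.cos v) := by
  rw [integral_exp_mul_cos_neg_pi_pi]
  have := besselI_zero_pos β
  positivity

/-! ### 2. Integration by parts against `e^{β cos v}` -/

/-- **Integration by parts on `[−π, π]`**: for a `C¹` function `F`,
`∫ F'(v) e^{β cos v} dv = (F(π) − F(−π)) e^{−β} + β ∫ F(v) sin v · e^{β cos v} dv`. -/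
theorem integral_deriv_mul_exp_mul_cos (β : ℝ) {F F' : ℝ → ℝ} (hF : ∀ v, HasDerivAt F (F' v) v)
    (hF' : Continuous F') :
    ∫ v in (-π)..π, F' v * Real.exp (β * Real.cos v) =
      (F π - F (-π)) * Real.exp (-β) +
        β * ∫ v in (-π)..π, F v * Real.sin v * Real.exp (β * Real.cos v) := by
  have hFc : Continuous F := continuous_iff_continuousAt.2 fun v => (hF v).continuousAt
  have hw : ∀ v, HasDerivAt (fun x => Real.exp (β * Real.cos x))
      (Real.exp (β * Real.cos v) * (β * -Real.sin v)) v :=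
    fun v => ((Real.hasDerivAt_cos v).const_mul β).exp
  have hprod : ∀ v, HasDerivAt (fun x => F x * Real.exp (β * Real.cos x))
      (F' v * Real.exp (β * Real.cos v) -
        β * (F v * Real.sin v * Real.exp (β * Real.cos v))) v := fun v =>
    ((hF v).mul (hw v)).congr_deriv (by ring)
  have hc1 : Continuous fun v => F' v * Real.exp (β * Real.cos v) := by fun_prop
  have hc2 : Continuous fun v => β * (F v * Real.sin v * Real.exp (β * Real.cos v)) := by fun_prop
  have hparts := integral_eq_sub_of_hasDerivAt (a := -π) (b := π) (fun v _ => hprod v)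
    ((hc1.sub hc2).intervalIntegrable _ _)
  rw [intervalIntegral.integral_sub (hc1.intervalIntegrable _ _) (hc2.intervalIntegrable _ _),
    intervalIntegral.integral_const_mul] at hparts
  simp only [Real.cos_neg, Real.cos_pi, mul_neg, mul_one] at hparts
  linarith

/-- `β ∫_{−π}^{π} v sin v · e^{β cos v} dv = 2π I₀(β) − 2π e^{−β}` (`F = id`). -/
theorem beta_mul_integral_id_mul_sin_mul_exp (β : ℝ) :
    β * ∫ v in (-π)..π, v * Real.sin v * Real.exp (β * Real.cos v) =
      2 * π * besselI 0 β - 2 * π * Real.exp (-β) := by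
  have h := integral_deriv_mul_exp_mul_cos β (F := fun v => v) (F' := fun _ => 1)
    (fun v => hasDerivAt_id' v) continuous_const
  simp only [one_mul, integral_exp_mul_cos_neg_pi_pi] at h
  linarith

/-- `β ∫_{−π}^{π} sin² v · e^{β cos v} dv = 2π I₁(β)` (`F = sin`; the boundary term vanishes). -/
theorem beta_mul_integral_sin_sq_mul_exp (β : ℝ) :
    β * ∫ v in (-π)..π, Real.sin v ^ 2 * Real.exp (β * Real.cos v) = 2 * π * besselI 1 β := by
  have h := integral_deriv_mul_exp_mul_cos β (F := Real.sin) (F' := Real.cos)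
    Real.hasDerivAt_sin Real.continuous_cos
  rw [integral_cos_mul_exp_mul_cos_neg_pi_pi] at h
  simp only [Real.sin_neg, Real.sin_pi, neg_zero, sub_self, zero_mul, zero_add] at h
  rw [h]
  congr 1
  refine intervalIntegral.integral_congr fun v _ => ?_
  simp only [sq]

/-- `β ∫_{−π}^{π} v³ sin v · e^{β cos v} dv = 3 ∫_{−π}^{π} v² e^{β cos v} dv − 2π³ e^{−β}` (`F = v³`). -/
theorem beta_mul_integral_cube_mul_sin_mul_exp (β : ℝ) :
    β * ∫ v in (-π)..π, v ^ 3 * Real.sin v * Real.exp (β * Real.cos v) =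
      3 * (∫ v in (-π)..π, v ^ 2 * Real.exp (β * Real.cos v)) - 2 * π ^ 3 * Real.exp (-β) := by
  have hd : ∀ v : ℝ, HasDerivAt (fun x : ℝ => x ^ 3) (3 * v ^ 2) v := fun v => by
    simpa using hasDerivAt_pow 3 v
  have h := integral_deriv_mul_exp_mul_cos β (F := fun v => v ^ 3) (F' := fun v => 3 * v ^ 2) hd
    (by fun_prop)
  have h3 : ∫ v in (-π)..π, 3 * v ^ 2 * Real.exp (β * Real.cos v) =
      3 * ∫ v in (-π)..π, v ^ 2 * Real.exp (β * Real.cos v) := by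
    rw [← intervalIntegral.integral_const_mul]
    refine intervalIntegral.integral_congr fun v _ => ?_
    ring
  rw [h3] at h
  have hb : ((π : ℝ) ^ 3 - (-π) ^ 3) * Real.exp (-β) = 2 * π ^ 3 * Real.exp (-β) := by ring
  rw [hb] at h
  linarith

/-! ### 3. Pointwise inequalities -/

/-- `v sin v · e^{β cos v} ≤ v² · e^{β cos v}` for every real `v` (`|sin v| ≤ |v|`; stated with the
weight, as it is used under the integral). -/
theorem id_mul_sin_mul_exp_le (β v : ℝ) :
    v * Real.sin v * Real.exp (β * Real.cos v) ≤ v ^ 2 * Real.exp (β * Real.cos v) := by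
  refine mul_le_mul_of_nonneg_right ?_ (Real.exp_pos _).le
  rcases le_or_gt 0 v with hv | hv
  · have := Real.sin_le hv
    nlinarith
  · have h := Real.sin_le (neg_nonneg.2 hv.le)
    rw [Real.sin_neg] at h
    nlinarith

/-- `v² ≤ sin² v + v⁴/3` for every real `v` (from `sin v > v − v³/6` for `v > 0` while `v² ≤ 3`,
and trivially beyond). -/
theorem sq_le_sin_sq_add_pow_four (v : ℝ) : v ^ 2 ≤ Real.sin v ^ 2 + v ^ 4 / 3 := by
  -- reduce to `u = |v| ≥ 0`
  suffices key : ∀ u : ℝ, 0 ≤ u → u ^ 2 ≤ Real.sin u ^ 2 + u ^ 4 / 3 by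
    rcases le_or_gt 0 v with hv | hv
    · exact key v hv
    · have h := key (-v) (neg_nonneg.2 hv.le)
      have e2 : (-v) ^ 2 = v ^ 2 := by ring
      have e4 : (-v) ^ 4 = v ^ 4 := by ring
      rw [e2, e4, Real.sin_neg, neg_sq] at h
      exact h
  intro u hu
  rcases hu.eq_or_lt with rfl | hu0
  · simp
  rcases le_or_gt (u ^ 2) 3 with h3 | h3
  · have hs : u - u ^ 3 / 6 < Real.sin u := Real.sin_gt_sub_cube hu0
    have hpos : 0 ≤ u - u ^ 3 / 6 := by nlinarith
    have hsq : (u - u ^ 3 / 6) ^ 2 ≤ Real.sin u ^ 2 := pow_le_pow_left₀ hpos hs.le 2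
    nlinarith [hsq, sq_nonneg (u ^ 3)]
  · nlinarith [sq_nonneg (Real.sin u), sq_nonneg u]

/-- `v⁴ ≤ v³ sin v + v⁶/6` for every real `v` (from `sin v > v − v³/6` for `v > 0`). -/
theorem pow_four_le_cube_mul_sin_add_pow_six (v : ℝ) :
    v ^ 4 ≤ v ^ 3 * Real.sin v + v ^ 6 / 6 := by
  suffices key : ∀ u : ℝ, 0 ≤ u → u ^ 4 ≤ u ^ 3 * Real.sin u + u ^ 6 / 6 by
    rcases le_or_gt 0 v with hv | hv
    · exact key v hv
    · have h := key (-v) (neg_nonneg.2 hv.le)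
      have h' : (-v) ^ 3 * Real.sin (-v) = v ^ 3 * Real.sin v := by rw [Real.sin_neg]; ring
      have e4 : (-v) ^ 4 = v ^ 4 := by ring
      have e6 : (-v) ^ 6 = v ^ 6 := by ring
      rw [h', e4, e6] at h
      exact h
  intro u hu
  rcases hu.eq_or_lt with rfl | hu0
  · simp
  have hs : u - u ^ 3 / 6 < Real.sin u := Real.sin_gt_sub_cube hu0
  have hu3 : 0 ≤ u ^ 3 := by positivity
  nlinarith [mul_le_mul_of_nonneg_left hs.le hu3]

/-- `2(1 − cos v) ≤ v²` for every real `v`. -/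
theorem two_mul_one_sub_cos_le_sq (v : ℝ) : 2 * (1 - Real.cos v) ≤ v ^ 2 := by
  have := Real.one_sub_sq_div_two_le_cos (x := v)
  linarith

/-- `sin² v · e^{β cos v} ≤ 2(1 − cos v) · e^{β cos v}` for every real `v`
(`sin² v = (1 − cos v)(1 + cos v)`; stated with the weight, as it is used under the integral). -/
theorem sin_sq_mul_exp_le (β v : ℝ) :
    Real.sin v ^ 2 * Real.exp (β * Real.cos v) ≤ 2 * (1 - Real.cos v) * Real.exp (β * Real.cos v) := by
  refine mul_le_mul_of_nonneg_right ?_ (Real.exp_pos _).le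
  nlinarith [Real.sin_sq_add_cos_sq v, Real.cos_le_one v, Real.neg_one_le_cos v]

/-! ### 4. Gaussian domination: the sixth moment and the normalisation -/

/-- `t³ e^{−ct} ≤ 27 e^{−3}/c³` for `c > 0`, `t ≥ 0` (the maximum is at `t = 3/c`; from `u ≤ e^{u−1}`). -/
theorem cube_mul_exp_neg_le {c t : ℝ} (hc : 0 < c) (ht : 0 ≤ t) :
    t ^ 3 * Real.exp (-(c * t)) ≤ 27 * Real.exp (-3) / c ^ 3 := by
  have hu : c * t / 3 ≤ Real.exp (c * t / 3 - 1) := by linarith [Real.add_one_le_exp (c * t / 3 - 1)]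
  have hu3 : (c * t / 3) ^ 3 ≤ Real.exp (c * t / 3 - 1) ^ 3 := pow_le_pow_left₀ (by positivity) hu 3
  have hexp : Real.exp (c * t / 3 - 1) ^ 3 = Real.exp (c * t) * Real.exp (-3) := by
    rw [← Real.exp_nat_mul, ← Real.exp_add]; congr 1; push_cast; ring
  rw [hexp] at hu3
  have hct : 0 < c ^ 3 := pow_pos hc 3
  rw [le_div_iff₀ hct]
  have hinv : Real.exp (c * t) * Real.exp (-(c * t)) = 1 := by
    rw [← Real.exp_add, add_neg_cancel, Real.exp_zero]
  calc t ^ 3 * Real.exp (-(c * t)) * c ^ 3 = 27 * ((c * t / 3) ^ 3 * Real.exp (-(c * t))) := by ring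
    _ ≤ 27 * (Real.exp (c * t) * Real.exp (-3) * Real.exp (-(c * t))) := by gcongr
    _ = 27 * Real.exp (-3) * (Real.exp (c * t) * Real.exp (-(c * t))) := by ring
    _ = 27 * Real.exp (-3) := by rw [hinv, mul_one]

/-- Pointwise Gaussian domination of the sixth-moment integrand on `[−π, π]` (`β > 0`):
`v⁶ e^{β cos v} ≤ (27 e^{−3} π⁶/β³) · e^β · e^{−(β/π²) v²}`. -/
theorem pow_six_mul_exp_mul_cos_le {β : ℝ} (hβ : 0 < β) {v : ℝ} (hv : v ∈ Icc (-π) π) :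
    v ^ 6 * Real.exp (β * Real.cos v) ≤
      27 * Real.exp (-3) * π ^ 6 / β ^ 3 * Real.exp β * Real.exp (-(β / π ^ 2 * v ^ 2)) := by
  have hπ : 0 < π := Real.pi_pos
  have hc : 0 < β / π ^ 2 := by positivity
  have habs : |v| ≤ π := abs_le.2 ⟨hv.1, hv.2⟩
  have hcos : Real.cos v ≤ 1 - 2 / π ^ 2 * v ^ 2 := Real.cos_le_one_sub_mul_cos_sq habs
  -- the weight
  have hw : Real.exp (β * Real.cos v) ≤
      Real.exp β * Real.exp (-(β / π ^ 2 * v ^ 2)) * Real.exp (-(β / π ^ 2 * v ^ 2)) := by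
    rw [← Real.exp_add, ← Real.exp_add]
    refine Real.exp_le_exp.2 ?_
    have := mul_le_mul_of_nonneg_left hcos hβ.le
    have h2 : β * (1 - 2 / π ^ 2 * v ^ 2) = β + -(β / π ^ 2 * v ^ 2) + -(β / π ^ 2 * v ^ 2) := by
      field_simp; ring
    linarith
  -- the polynomial factor
  have hpoly : v ^ 6 * Real.exp (-(β / π ^ 2 * v ^ 2)) ≤ 27 * Real.exp (-3) / (β / π ^ 2) ^ 3 := by
    have h := cube_mul_exp_neg_le hc (sq_nonneg v)
    calc v ^ 6 * Real.exp (-(β / π ^ 2 * v ^ 2)) = (v ^ 2) ^ 3 * Real.exp (-(β / π ^ 2 * v ^ 2)) := by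
          ring
      _ ≤ _ := h
  have hK : 27 * Real.exp (-3) / (β / π ^ 2) ^ 3 = 27 * Real.exp (-3) * π ^ 6 / β ^ 3 := by
    rw [div_pow, div_div_eq_mul_div]; ring
  rw [hK] at hpoly
  have h6 : 0 ≤ v ^ 6 := by positivity
  calc v ^ 6 * Real.exp (β * Real.cos v)
      ≤ v ^ 6 * (Real.exp β * Real.exp (-(β / π ^ 2 * v ^ 2)) * Real.exp (-(β / π ^ 2 * v ^ 2))) :=
        mul_le_mul_of_nonneg_left hw h6
    _ = (v ^ 6 * Real.exp (-(β / π ^ 2 * v ^ 2))) * (Real.exp β * Real.exp (-(β / π ^ 2 * v ^ 2))) := by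
        ring
    _ ≤ (27 * Real.exp (-3) * π ^ 6 / β ^ 3) * (Real.exp β * Real.exp (-(β / π ^ 2 * v ^ 2))) :=
        mul_le_mul_of_nonneg_right hpoly (by positivity)
    _ = _ := by ring

/-- The truncated Gaussian integral is at most the full one: `∫_{−π}^{π} e^{−c v²} dv ≤ √(π/c)` (`c > 0`). -/
theorem integral_exp_neg_mul_sq_neg_pi_pi_le {c : ℝ} (hc : 0 < c) :
    ∫ v in (-π)..π, Real.exp (-(c * v ^ 2)) ≤ Real.sqrt (π / c) := by
  have hle : -π ≤ π := by linarith [Real.pi_pos]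
  rw [intervalIntegral.integral_of_le hle, ← integral_gaussian c]
  have hi : Integrable (fun v : ℝ => Real.exp (-c * v ^ 2)) := integrable_exp_neg_mul_sq hc
  have heq : (fun v : ℝ => Real.exp (-(c * v ^ 2))) = fun v => Real.exp (-c * v ^ 2) := by
    funext v; ring_nf
  rw [heq]
  exact setIntegral_le_integral hi (Filter.Eventually.of_forall fun v => (Real.exp_pos _).le)

/-- **Sixth-moment numerator bound** (`β > 0`):
`∫_{−π}^{π} v⁶ e^{β cos v} dv ≤ (27 e^{−3} π⁶/β³) · e^β · √(π³/β)`. -/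
theorem integral_pow_six_mul_exp_mul_cos_le {β : ℝ} (hβ : 0 < β) :
    ∫ v in (-π)..π, v ^ 6 * Real.exp (β * Real.cos v) ≤
      27 * Real.exp (-3) * π ^ 6 / β ^ 3 * Real.exp β * Real.sqrt (π ^ 3 / β) := by
  have hπ : 0 < π := Real.pi_pos
  have hle : -π ≤ π := by linarith
  have hc : 0 < β / π ^ 2 := by positivity
  set K := 27 * Real.exp (-3) * π ^ 6 / β ^ 3 * Real.exp β with hK
  have hK0 : 0 ≤ K := by positivity
  have h1 : ∫ v in (-π)..π, v ^ 6 * Real.exp (β * Real.cos v) ≤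
      ∫ v in (-π)..π, K * Real.exp (-(β / π ^ 2 * v ^ 2)) := by
    refine intervalIntegral.integral_mono_on hle ?_ ?_ fun v hv => ?_
    · exact (by fun_prop : Continuous fun v => v ^ 6 * Real.exp (β * Real.cos v)).intervalIntegrable _ _
    · exact (by fun_prop : Continuous fun v => K * Real.exp (-(β / π ^ 2 * v ^ 2))).intervalIntegrable
        _ _
    · have := pow_six_mul_exp_mul_cos_le hβ hv
      simpa only [hK] using this
  refine h1.trans ?_
  rw [intervalIntegral.integral_const_mul]
  refine mul_le_mul_of_nonneg_left ?_ hK0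
  have h2 := integral_exp_neg_mul_sq_neg_pi_pi_le hc
  have h3 : π / (β / π ^ 2) = π ^ 3 / β := by rw [div_div_eq_mul_div]; ring
  rwa [h3] at h2

/-- **Normalisation lower bound** (`β ≥ 1`): `∫_{−π}^{π} e^{β cos v} dv ≥ (5/3) e^β/√β`
(on `|v| ≤ 1/√β ≤ π`, `e^{β cos v} ≥ e^{β(1 − v²/2)} ≥ e^β (1 − βv²/2)`, and
`∫_{−s}^{s} (1 − βv²/2) dv = 2s − βs³/3 = (5/3)s` at `s = 1/√β`). -/
theorem integral_exp_mul_cos_neg_pi_pi_ge {β : ℝ} (hβ : 1 ≤ β) :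
    5 / 3 * Real.exp β / Real.sqrt β ≤ ∫ v in (-π)..π, Real.exp (β * Real.cos v) := by
  have hβ0 : 0 < β := by linarith
  have hπ : 0 < π := Real.pi_pos
  set s := (Real.sqrt β)⁻¹ with hs
  have hsq : 0 < Real.sqrt β := Real.sqrt_pos.2 hβ0
  have hs0 : 0 < s := inv_pos.2 hsq
  have hs1 : s ≤ 1 := by
    rw [hs]; exact inv_le_one_of_one_le₀ (Real.one_le_sqrt.2 hβ)
  have hsπ : s ≤ π := hs1.trans (by linarith [Real.two_le_pi])
  have hss : s ^ 2 * β = 1 := by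
    rw [hs, inv_pow, Real.sq_sqrt hβ0.le, inv_mul_cancel₀ hβ0.ne']
  -- restrict to `[−s, s]`
  have hsub : ∫ v in (-s)..s, Real.exp (β * Real.cos v) ≤ ∫ v in (-π)..π, Real.exp (β * Real.cos v) := by
    refine intervalIntegral.integral_mono_interval (by linarith) (by linarith) hsπ ?_ ?_
    · exact Filter.Eventually.of_forall fun v => (Real.exp_pos _).le
    · exact (by fun_prop : Continuous fun v => Real.exp (β * Real.cos v)).intervalIntegrable _ _
  refine le_trans ?_ hsub
  -- lower bound on `[−s, s]` by the polynomial
  have hpoly : ∫ v in (-s)..s, Real.exp β * (1 - β * v ^ 2 / 2) ≤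
      ∫ v in (-s)..s, Real.exp (β * Real.cos v) := by
    refine intervalIntegral.integral_mono_on (by linarith) ?_ ?_ fun v _ => ?_
    · exact (by fun_prop : Continuous fun v => Real.exp β * (1 - β * v ^ 2 / 2)).intervalIntegrable _ _
    · exact (by fun_prop : Continuous fun v => Real.exp (β * Real.cos v)).intervalIntegrable _ _
    · have hcos : 1 - v ^ 2 / 2 ≤ Real.cos v := Real.one_sub_sq_div_two_le_cos
      have h1 : Real.exp β * Real.exp (-(β * v ^ 2 / 2)) ≤ Real.exp (β * Real.cos v) := by
        rw [← Real.exp_add]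
        exact Real.exp_le_exp.2 (by nlinarith)
      have h2 : 1 - β * v ^ 2 / 2 ≤ Real.exp (-(β * v ^ 2 / 2)) := by
        linarith [Real.add_one_le_exp (-(β * v ^ 2 / 2))]
      exact (mul_le_mul_of_nonneg_left h2 (Real.exp_pos β).le).trans h1
  refine le_trans (le_of_eq ?_) hpoly
  -- evaluate the polynomial integral
  have hd : ∀ v : ℝ, HasDerivAt (fun x : ℝ => Real.exp β * (x - β * x ^ 3 / 6))
      (Real.exp β * (1 - β * v ^ 2 / 2)) v := fun v => by
    have h := ((hasDerivAt_id' v).sub ((hasDerivAt_pow 3 v).const_mul β |>.div_const 6)).const_mul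
      (Real.exp β)
    refine h.congr_deriv ?_
    push_cast; ring
  rw [integral_eq_sub_of_hasDerivAt (fun v _ => hd v)
    ((by fun_prop : Continuous fun v => Real.exp β * (1 - β * v ^ 2 / 2)).intervalIntegrable _ _)]
  have hs3 : β * s ^ 3 = s := by
    calc β * s ^ 3 = (s ^ 2 * β) * s := by ring
      _ = s := by rw [hss, one_mul]
  rw [div_eq_mul_inv, ← hs]
  linear_combination (Real.exp β / 3) * hs3

/-- **The sixth moment of the plaquette angle** (`β ≥ 1`):
`⟨v⁶⟩_β = ∫ v⁶ e^{β cos v} / ∫ e^{β cos v} ≤ (81/5) e^{−3} π⁷ √π / β³` (`≈ 4318/β³`). -/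
theorem sixthMoment_plaquetteAngle_le {β : ℝ} (hβ : 1 ≤ β) :
    (∫ v in (-π)..π, v ^ 6 * Real.exp (β * Real.cos v)) /
        (∫ v in (-π)..π, Real.exp (β * Real.cos v)) ≤
      81 / 5 * Real.exp (-3) * π ^ 7 * Real.sqrt π / β ^ 3 := by
  have hβ0 : 0 < β := by linarith
  have hπ : 0 < π := Real.pi_pos
  have hZ := integral_exp_mul_cos_neg_pi_pi_pos β
  have hnum := integral_pow_six_mul_exp_mul_cos_le hβ0
  have hden := integral_exp_mul_cos_neg_pi_pi_ge hβ
  have hsq : 0 < Real.sqrt β := Real.sqrt_pos.2 hβ0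
  have hB : 0 < 5 / 3 * Real.exp β / Real.sqrt β := by positivity
  rw [div_le_iff₀ hZ]
  refine hnum.trans ?_
  -- compare `A ≤ C · B ≤ C · Z`
  have hsplit : Real.sqrt (π ^ 3 / β) = π * Real.sqrt π / Real.sqrt β := by
    rw [Real.sqrt_div' _ hβ0.le, show (π : ℝ) ^ 3 = π ^ 2 * π by ring,
      Real.sqrt_mul (by positivity), Real.sqrt_sq hπ.le]
  rw [hsplit]
  have key : 27 * Real.exp (-3) * π ^ 6 / β ^ 3 * Real.exp β * (π * Real.sqrt π / Real.sqrt β) =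
      81 / 5 * Real.exp (-3) * π ^ 7 * Real.sqrt π / β ^ 3 * (5 / 3 * Real.exp β / Real.sqrt β) := by
    field_simp
    ring
  rw [key]
  exact mul_le_mul_of_nonneg_left hden (by positivity)

end Summit.Ventures.LatticeQCDFlow.Scoring
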